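import Summits.QuantumFields.YangMills.Theorems.BalabanLadderUVSeamRecFloorsEngineOfWindow
import HarnessLib

/-!
# Crux `UVSeamRec` (stmt-QuantumFields-20043): the seam from an ENGINE-AGNOSTIC window package at one engine unit

Helper file (`--supports stmt-QuantumFields-20043`) of the lead prover (unit `ym-spine-20043-p1`, gen 2); companion of
`BalabanLadderUVSeamRecFloorsEngineOfWindow` (α ≡ ω check-lemmas).

Both legs of the seam body `∃ r, LowerBounds SU(2) r uRec ∧ MomentBounds6 SU(2) r uRec` come, on either supplier path
of the line of record (femto: CFP6 data; Track A: Bałaban's densities at the flow unit), from ONE engine at ONE unit `a`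
for ONE representation `r`.  This file records the engine-agnostic glue: window floors over `[s₁, s₂]` (the same
witnesses floor `Q2(θv, v)` / `|Q3(f, g, h)|` at every smearing scale `a β / s`, `s ∈ [s₁, s₂]`; compact support NOT
required) and the plane-resolved ceilings `MomentBounds6 SU(2) r a` at a unit with `s₁ ≤ a β / uRec β ≤ s₂` eventually
(`0 < s₁`; the ratio need NOT converge — Bałaban's flow unit `a_B = L^{-k(β)}` is DISCRETE and log-periodic against
`uRec`, so it can only ever enter this way) give the seam body (`uvSeamRecBody_of_windowPackage`: floors by
`WindowTransfer.lowerBounds_of_window`, ceilings one-sidedly by `CeilingsTransfer.momentBounds6_of_eventually_le` with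
`a ≤ s₂ · uRec`) and hence the route decl with its `UV` hypothesis unused (`uvSeamRec_of_windowPackage`, D0 transport
`Transport.stub_transport_proved`).  The ceilings are consumed for the floors witness `r` ONLY — the registered
`stub_ceilings` asks them for every lattice representation of `SU(2)`.
-/

set_option autoImplicit false

noncomputable section

open scoped SchwartzMap
open MeasureTheory Filter Topology
open Literature.MathematicalPhysics.QuantumFieldTheory Literature.MathematicalPhysics.QuantumLattice
open Summit.QuantumFields.YangMills.Cruxes.OSLegsFromFemtoAndGap.DlrCollarTransfer

namespace Summit.QuantumFields.YangMills.Cruxes.UVSeamRec.SeamOfWindowPackage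

/-- **ENGINE-AGNOSTIC seam body from a window package at ONE engine unit** (`SU(2)`, Borel): ONE lattice
representation `r` of `SU(2)` and an engine unit `a` with `s₁ ≤ a β / uRec β ≤ s₂` eventually (`0 < s₁`), carrying
window floors over `[s₁, s₂]` AND the plane-resolved ceilings `MomentBounds6 SU(2) r a` ⇒
`∃ r, LowerBounds SU(2) r uRec ∧ MomentBounds6 SU(2) r uRec`. [folklore] -/
theorem uvSeamRecBody_of_windowPackage
    (hpkg : letI : MeasurableSpace (Matrix.specialUnitaryGroup (Fin 2) ℂ) := borel _
      haveI : BorelSpace (Matrix.specialUnitaryGroup (Fin 2) ℂ) := ⟨rfl⟩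
      ∃ (r : LatticeRep (Matrix.specialUnitaryGroup (Fin 2) ℂ)) (a : ℝ → ℝ) (s₁ s₂ : ℝ), 0 < s₁ ∧
        (∀ᶠ β in atTop, s₁ ≤ a β / Transport.uRec β ∧ a β / Transport.uRec β ≤ s₂) ∧
        (∃ (v : 𝓢(EuclideanSpace ℝ (Fin 4), ℝ)) (ε β₅ Λ₅ : ℝ),
          tsupport (v : EuclideanSpace ℝ (Fin 4) → ℝ) ⊆ {y : EuclideanSpace ℝ (Fin 4) | 0 < y 0} ∧ 0 < ε ∧
          ∀ s ∈ Set.Icc s₁ s₂, ∀ β : ℝ, β₅ ≤ β → ∀ L : ℕ, Λ₅ ≤ a β * L →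
            ε ≤ Q2 (Matrix.specialUnitaryGroup (Fin 2) ℂ) r β L (a β / s) (thetaTest 4 v) v) ∧
        (∃ (f g h : 𝓢(EuclideanSpace ℝ (Fin 4), ℝ)) (ε β₅ Λ₅ : ℝ),
          Disjoint (tsupport (f : EuclideanSpace ℝ (Fin 4) → ℝ)) (tsupport (g : EuclideanSpace ℝ (Fin 4) → ℝ)) ∧
          Disjoint (tsupport (g : EuclideanSpace ℝ (Fin 4) → ℝ)) (tsupport (h : EuclideanSpace ℝ (Fin 4) → ℝ)) ∧
          Disjoint (tsupport (f : EuclideanSpace ℝ (Fin 4) → ℝ)) (tsupport (h : EuclideanSpace ℝ (Fin 4) → ℝ)) ∧ 0 < ε ∧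
          ∀ s ∈ Set.Icc s₁ s₂, ∀ β : ℝ, β₅ ≤ β → ∀ L : ℕ, Λ₅ ≤ a β * L →
            ε ≤ |Q3 (Matrix.specialUnitaryGroup (Fin 2) ℂ) r β L (a β / s) f g h|) ∧
        MomentBounds6 (Matrix.specialUnitaryGroup (Fin 2) ℂ) r a) :
    letI : MeasurableSpace (Matrix.specialUnitaryGroup (Fin 2) ℂ) := borel _
    haveI : BorelSpace (Matrix.specialUnitaryGroup (Fin 2) ℂ) := ⟨rfl⟩
    ∃ r : LatticeRep (Matrix.specialUnitaryGroup (Fin 2) ℂ),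
      LowerBounds (Matrix.specialUnitaryGroup (Fin 2) ℂ) r Transport.uRec ∧
        MomentBounds6 (Matrix.specialUnitaryGroup (Fin 2) ℂ) r Transport.uRec := by
  letI : MeasurableSpace (Matrix.specialUnitaryGroup (Fin 2) ℂ) := borel _
  haveI : BorelSpace (Matrix.specialUnitaryGroup (Fin 2) ℂ) := ⟨rfl⟩
  obtain ⟨r, a, s₁, s₂, hs₁, hwin, h2, h3, hMB⟩ := hpkg
  have hs₂ : 0 < s₂ := by
    obtain ⟨β, hβ⟩ := hwin.exists
    exact hs₁.trans_le (hβ.1.trans hβ.2)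
  exact ⟨r, WindowTransfer.lowerBounds_of_window r hs₁ UnitTransfer.uRec_pos hwin h2 h3,
    CeilingsTransfer.momentBounds6_of_eventually_le r hs₂ (FloorsEngineOfWindow.eventually_le_of_window hwin) hMB⟩

/-- **`UVSeamRec` from an engine-agnostic window package at `SU(2)` — its `UV` hypothesis UNUSED** (to be fed, on the
Track-A path, by a `UV`-consuming supplier of the package; on the femto path by CFP6 data through
`FloorsEngineOfWindow.windowFloorsC_of_fcp_ratio` + `stub_collar6`). [folklore] -/
theorem uvSeamRec_of_windowPackage
    (hpkg : letI : MeasurableSpace (Matrix.specialUnitaryGroup (Fin 2) ℂ) := borel _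
      haveI : BorelSpace (Matrix.specialUnitaryGroup (Fin 2) ℂ) := ⟨rfl⟩
      ∃ (r : LatticeRep (Matrix.specialUnitaryGroup (Fin 2) ℂ)) (a : ℝ → ℝ) (s₁ s₂ : ℝ), 0 < s₁ ∧
        (∀ᶠ β in atTop, s₁ ≤ a β / Transport.uRec β ∧ a β / Transport.uRec β ≤ s₂) ∧
        (∃ (v : 𝓢(EuclideanSpace ℝ (Fin 4), ℝ)) (ε β₅ Λ₅ : ℝ),
          tsupport (v : EuclideanSpace ℝ (Fin 4) → ℝ) ⊆ {y : EuclideanSpace ℝ (Fin 4) | 0 < y 0} ∧ 0 < ε ∧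
          ∀ s ∈ Set.Icc s₁ s₂, ∀ β : ℝ, β₅ ≤ β → ∀ L : ℕ, Λ₅ ≤ a β * L →
            ε ≤ Q2 (Matrix.specialUnitaryGroup (Fin 2) ℂ) r β L (a β / s) (thetaTest 4 v) v) ∧
        (∃ (f g h : 𝓢(EuclideanSpace ℝ (Fin 4), ℝ)) (ε β₅ Λ₅ : ℝ),
          Disjoint (tsupport (f : EuclideanSpace ℝ (Fin 4) → ℝ)) (tsupport (g : EuclideanSpace ℝ (Fin 4) → ℝ)) ∧
          Disjoint (tsupport (g : EuclideanSpace ℝ (Fin 4) → ℝ)) (tsupport (h : EuclideanSpace ℝ (Fin 4) → ℝ)) ∧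
          Disjoint (tsupport (f : EuclideanSpace ℝ (Fin 4) → ℝ)) (tsupport (h : EuclideanSpace ℝ (Fin 4) → ℝ)) ∧ 0 < ε ∧
          ∀ s ∈ Set.Icc s₁ s₂, ∀ β : ℝ, β₅ ≤ β → ∀ L : ℕ, Λ₅ ≤ a β * L →
            ε ≤ |Q3 (Matrix.specialUnitaryGroup (Fin 2) ℂ) r β L (a β / s) f g h|) ∧
        MomentBounds6 (Matrix.specialUnitaryGroup (Fin 2) ℂ) r a) :
    Summit.QuantumFields.YangMills.Theses.BalabanLadder.UVSeamRec := by
  intro _hUV G _ _ _ _ hG hne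
  exact Transport.stub_transport_proved (uvSeamRecBody_of_windowPackage hpkg) G hG hne

end Summit.QuantumFields.YangMills.Cruxes.UVSeamRec.SeamOfWindowPackage

end
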